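import Mathlib
import Literature.AlgebraicGeometry.HodgeTheory.FermatHodgeCharacters
import Literature.AlgebraicGeometry.HodgeTheory.FermatShiodaCondition
import HarnessLib

/-!
# Fermat cycles — the explicit complete-intersection family `Z_d ⊂ X⁴_{2d}` (cell `pub-hfermat`, search-1 Hit 10)

HONEST FRAMING: explicit algebraic cycles for specific Hodge classes on Fermat/Delsarte varieties;
residual open instances listed; no claim on general Hodge.

For `d = 4q` the cell's unit `search-1` (gen-3) exhibits the complete intersection
`Z_d = V(f₁, f₂, f₃) ⊂ ℙ⁵`,
  `f₁ = x₄⁸ − κ·N·x₃⁴`, `f₂ = x₃^d − λ·((x₀x₂)^{d/2} + (x₁x₅)^{d/2}) + 2·N^{d/4}`, `f₃ = x₀^d + x₂^d − i·(x₁^d + x₅^d)`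
(`N = x₀x₁x₂x₅`, `λ² = 2`, `κ^{d/4} = 4`, `i² = −1`; over `ℚ(i, √2, 2^{8/d})` one may take `λ = √2`, `κ = 2^{8/d}`),
of multidegree `(8, d, d)`, as an explicit algebraic surface on the Fermat fourfold `X⁴_{2d} = {Σ x_j^{2d} = 0}`.

What is KERNEL-CHECKED here (and nothing more):
* `fermat_mem_span` — the polynomial identity `Σ_j x_j^{2d} = f₁g₁ + f₂g₂ + f₃g₃` with explicit cofactors, in every
  commutative ring containing elements `i, λ, κ` with `i² = −1`, `λ² = 2`, `κ^q = 4` (`d = 4q`): i.e. `Z_d` lies on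
  `X⁴_{2d}` for every `d ≡ 0 (mod 4)`. This is also exactly the input format of Villaflor Loyola's period formula for
  complete-intersection cycles [Villaflor2022PeriodsCI, Thm 2], which the cell uses (outside Lean) to certify the class.
* `isHodge_gamma_*` — the target characters `γ_d = (1, d/2+1, d+1, d+4, 2d−8, 3d/2+1)` are Hodge characters of
  `X⁴_{2d}` (Shioda's criterion, kernel decision) for `d = 16, 24, 28, 32`.

What is NOT formalised (numerical / pen-and-paper in the cell, two independent implementations agreeing for all
fourteen `d = 8, 12, …, 60`; files `run/shared/lean/pub/pub-hfermat/pub-hfermat-search-1/CANCEL-EXPLICIT.md`,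
`out/cx/zfam_d*_p*.json`): the period `∫_{Z_d} ω_b` is non-zero for exactly `4(d−4)` characters `b`, among them every
unit multiple of `γ_d`; hence the eigenlines `V(±tγ_d)` — grade "E3" (algebraic only through Shioda's inductive
structure [Shioda1979HodgeFermat, Thm II and Lemma 3], no constructible cycle previously recorded) at
`2d = 32, 48, 56, 64, 72, 80, 88, 96, 104, 112, 120` in the cell's census — are spanned by classes of the explicit
cycles `g·Z_d`, `g ∈ μ_{2d}⁶`.

References: [Shioda1979HodgeFermat] T. Shioda, The Hodge conjecture for Fermat varieties, Math. Ann. 245 (1979)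
175–184, Thm I, Thm II with (2.7), Lemma 3; [AokiShioda1983] N. Aoki, T. Shioda, Generators of the Néron–Severi
group of a Fermat surface, Progr. Math. 35 (1983) 1–12, Thms 1–3; [Villaflor2022PeriodsCI] R. Villaflor Loyola,
Periods of complete intersection algebraic cycles, manuscripta math. 167 (2022) 765–792 (arXiv:1812.03964), Thm 2.
-/

open Finset
open Literature.AlgebraicGeometry.HodgeTheory Literature.AlgebraicGeometry.HodgeTheory.FermatCharacter

namespace Summit.HodgeConjecture.FermatCycles.ExplicitE3Family

section Ideal

variable {R : Type*} [CommRing R]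

/-- The three equations of `Z_d` and their cofactors, `d = 4q`. [folklore] -/
def fOne (kap x0 x1 x2 x3 x4 x5 : R) : R := x4 ^ 8 - kap * (x0 * x1 * x2 * x5) * x3 ^ 4

/-- Cofactor of `f₁`: the geometric sum with `f₁ · g₁ = x₄^{8q} − (κ N x₃⁴)^q`. [folklore] -/
def gOne (q : ℕ) (kap x0 x1 x2 x3 x4 x5 : R) : R :=
  ∑ i ∈ range q, (x4 ^ 8) ^ i * (kap * (x0 * x1 * x2 * x5) * x3 ^ 4) ^ (q - 1 - i)

/-- `f₂ = x₃^{4q} − λ((x₀x₂)^{2q} + (x₁x₅)^{2q}) + 2 N^q`. [folklore] -/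
def fTwo (q : ℕ) (lam x0 x1 x2 x3 x5 : R) : R :=
  x3 ^ (4 * q) - lam * ((x0 * x2) ^ (2 * q) + (x1 * x5) ^ (2 * q)) + 2 * (x0 * x1 * x2 * x5) ^ q

/-- `g₂ = x₃^{4q} + λ((x₀x₂)^{2q} + (x₁x₅)^{2q}) + 2 N^q`. [folklore] -/
def gTwo (q : ℕ) (lam x0 x1 x2 x3 x5 : R) : R :=
  x3 ^ (4 * q) + lam * ((x0 * x2) ^ (2 * q) + (x1 * x5) ^ (2 * q)) + 2 * (x0 * x1 * x2 * x5) ^ q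

/-- `f₃ = x₀^{4q} + x₂^{4q} − i (x₁^{4q} + x₅^{4q})`. [folklore] -/
def fThree (q : ℕ) (I x0 x1 x2 x5 : R) : R :=
  x0 ^ (4 * q) + x2 ^ (4 * q) - I * (x1 ^ (4 * q) + x5 ^ (4 * q))

/-- `g₃ = x₀^{4q} + x₂^{4q} + i (x₁^{4q} + x₅^{4q})`. [folklore] -/
def gThree (q : ℕ) (I x0 x1 x2 x5 : R) : R :=
  x0 ^ (4 * q) + x2 ^ (4 * q) + I * (x1 ^ (4 * q) + x5 ^ (4 * q))

/-- `f₁ · g₁ = x₄^{8q} − (κ N x₃⁴)^q` (telescoping). [folklore] -/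
theorem fOne_mul_gOne (q : ℕ) (kap x0 x1 x2 x3 x4 x5 : R) :
    fOne kap x0 x1 x2 x3 x4 x5 * gOne q kap x0 x1 x2 x3 x4 x5
      = (x4 ^ 8) ^ q - (kap * (x0 * x1 * x2 * x5) * x3 ^ 4) ^ q := by
  unfold fOne gOne
  rw [mul_comm]
  exact geom_sum₂_mul _ _ _

/-- IDEAL MEMBERSHIP: for `d = 4q`, the Fermat polynomial of degree `2d = 8q` in six variables equals
`f₁g₁ + f₂g₂ + f₃g₃`; so the complete intersection `Z_d = V(f₁,f₂,f₃)` lies on the Fermat fourfold `X⁴_{2d}`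
whenever `i² = −1`, `λ² = 2`, `κ^q = 4`. [folklore] -/
theorem fermat_eq_combination (q : ℕ) (I lam kap x0 x1 x2 x3 x4 x5 : R)
    (hI : I ^ 2 = -1) (hlam : lam ^ 2 = 2) (hkap : kap ^ q = 4) :
    x0 ^ (8 * q) + x1 ^ (8 * q) + x2 ^ (8 * q) + x3 ^ (8 * q) + x4 ^ (8 * q) + x5 ^ (8 * q)
      = fOne kap x0 x1 x2 x3 x4 x5 * gOne q kap x0 x1 x2 x3 x4 x5
        + fTwo q lam x0 x1 x2 x3 x5 * gTwo q lam x0 x1 x2 x3 x5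
        + fThree q I x0 x1 x2 x5 * gThree q I x0 x1 x2 x5 := by
  have hg := fOne_mul_gOne q kap x0 x1 x2 x3 x4 x5
  rw [hg]
  unfold fTwo gTwo fThree gThree
  have e1 : x3 ^ (8 * q) = (x3 ^ (4 * q)) ^ 2 := by rw [← pow_mul]; ring_nf
  have e2 : x4 ^ (8 * q) = (x4 ^ 8) ^ q := by rw [← pow_mul]
  have e3 : (kap * (x0 * x1 * x2 * x5) * x3 ^ 4) ^ q = kap ^ q * (x0 * x1 * x2 * x5) ^ q * x3 ^ (4 * q) := by
    rw [mul_pow, mul_pow, ← pow_mul]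
  have e4 : ∀ y : R, y ^ (8 * q) = (y ^ (4 * q)) ^ 2 := fun y => by rw [← pow_mul]; ring_nf
  have e5 : ∀ y z : R, (y * z) ^ (2 * q) * (y * z) ^ (2 * q) = y ^ (4 * q) * z ^ (4 * q) := fun y z => by
    rw [← pow_add, mul_pow]; ring_nf
  have e6 : (x0 * x1 * x2 * x5) ^ q * (x0 * x1 * x2 * x5) ^ q = (x0 * x2) ^ (2 * q) * (x1 * x5) ^ (2 * q) := by
    rw [← pow_add, ← two_mul, mul_pow, mul_pow, mul_pow, mul_pow]; ring
  rw [e1, e2, e3, e4 x0, e4 x1, e4 x2, e4 x5, hkap]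
  linear_combination (x1 ^ (4 * q) + x5 ^ (4 * q)) ^ 2 * hI
    + ((x0 * x2) ^ (2 * q) + (x1 * x5) ^ (2 * q)) ^ 2 * hlam
    + (2 : R) * e5 x0 x2 + (2 : R) * e5 x1 x5 + (4 : R) * e6

/-- The same statement as membership in the ideal `(f₁, f₂, f₃)`. [folklore] -/
theorem fermat_mem_span (q : ℕ) (I lam kap x0 x1 x2 x3 x4 x5 : R)
    (hI : I ^ 2 = -1) (hlam : lam ^ 2 = 2) (hkap : kap ^ q = 4) :
    x0 ^ (8 * q) + x1 ^ (8 * q) + x2 ^ (8 * q) + x3 ^ (8 * q) + x4 ^ (8 * q) + x5 ^ (8 * q)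
      ∈ Ideal.span ({fOne kap x0 x1 x2 x3 x4 x5, fTwo q lam x0 x1 x2 x3 x5, fThree q I x0 x1 x2 x5} : Set R) := by
  rw [fermat_eq_combination q I lam kap x0 x1 x2 x3 x4 x5 hI hlam hkap]
  refine Ideal.add_mem _ (Ideal.add_mem _ ?_ ?_) ?_
  · exact Ideal.mul_mem_right _ _ (Ideal.subset_span (by simp))
  · exact Ideal.mul_mem_right _ _ (Ideal.subset_span (by simp))
  · exact Ideal.mul_mem_right _ _ (Ideal.subset_span (by simp))

end Ideal

section Characters

/-- `γ₁₆ = (1, 9, 17, 20, 24, 25)`, the target character of `Z₁₆ ⊂ X⁴₃₂` (grade E3 in the cell's census). [folklore] -/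
def gamma32 : Fin (2 * 2 + 2) → ZMod 32 := ![1, 9, 17, 20, 24, 25]

/-- `γ₂₄ = (1, 13, 25, 28, 40, 37)` on `X⁴₄₈`. [folklore] -/
def gamma48 : Fin (2 * 2 + 2) → ZMod 48 := ![1, 13, 25, 28, 40, 37]

/-- `γ₂₈ = (1, 15, 29, 32, 48, 43)` on `X⁴₅₆`. [folklore] -/
def gamma56 : Fin (2 * 2 + 2) → ZMod 56 := ![1, 15, 29, 32, 48, 43]

/-- `γ₃₂ = (1, 17, 33, 36, 56, 49)` on `X⁴₆₄`. [folklore] -/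
def gamma64 : Fin (2 * 2 + 2) → ZMod 64 := ![1, 17, 33, 36, 56, 49]

/-- `γ₁₆` is a Hodge character of `X⁴₃₂` (Shioda's criterion). [cite: Shioda1979HodgeFermat, Thm I] -/
theorem isHodge_gamma32 : IsHodge gamma32 := by
  refine (isHodge_iff_isHodgeMultiset _).2 ?_
  unfold IsHodgeMultiset mNormSum gamma32
  decide +kernel

/-- `γ₂₄` is a Hodge character of `X⁴₄₈`. [cite: Shioda1979HodgeFermat, Thm I] -/
theorem isHodge_gamma48 : IsHodge gamma48 := by
  refine (isHodge_iff_isHodgeMultiset _).2 ?_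
  unfold IsHodgeMultiset mNormSum gamma48
  decide +kernel

/-- `γ₂₈` is a Hodge character of `X⁴₅₆`. [cite: Shioda1979HodgeFermat, Thm I] -/
theorem isHodge_gamma56 : IsHodge gamma56 := by
  refine (isHodge_iff_isHodgeMultiset _).2 ?_
  unfold IsHodgeMultiset mNormSum gamma56
  decide +kernel

/-- `γ₃₂` is a Hodge character of `X⁴₆₄`. [cite: Shioda1979HodgeFermat, Thm I] -/
theorem isHodge_gamma64 : IsHodge gamma64 := by
  refine (isHodge_iff_isHodgeMultiset _).2 ?_
  unfold IsHodgeMultiset mNormSum gamma64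
  decide +kernel

end Characters

end Summit.HodgeConjecture.FermatCycles.ExplicitE3Family
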